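import Summits.BirchSwinnertonDyer.BirchSwinnertonDyer.Theorems.CMKolyvaginAtInertTwoCMKolyvaginConjectureAtInertTwoPositiveDepthGenusCharacterDescentAllLevels
import Summits.BirchSwinnertonDyer.BirchSwinnertonDyer.Theses.CMKolyvaginAtInertTwo
import HarnessLib

/-!
# Crux `CMKolyvaginConjectureAtInertTwo` (stmt-BirchSwinnertonDyer-24648) BY NAME ⟺ the RATIONAL TWIST DICHOTOMY over `K`:
# on every H₂ frame, `y_K ∉ 2E(K[1])`, or at some square-free CM-inert Kolyvagin level `n` the signed genus trace `G_{χ_Θ}`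
# is not twice the transport of a `K`-RATIONAL point of the quadratic twist `E^{(n*)}`

Route `CMKolyvaginAtInertTwo` (cell `pub/bsd-eis`, seat `leafhand-bsd-cmkolyvaginatinert-4` g0); helper (`--supports
stmt-BirchSwinnertonDyer-24648 --as helper`). THEOREMS ONLY (no definition, no named fact, no `sorry`); closes nothing.

Capstone of this seat's `K`-descent (`…GenusCharacterDescentAllLevels`, p824620; compare hand -3's `K[1]`-capstone
`cmKolyvaginConjectureAtInertTwo_iff_twistDichotomy`, p822756): the route decl
`Summit.BirchSwinnertonDyer.BirchSwinnertonDyer.Theses.CMKolyvaginAtInertTwo.CMKolyvaginConjectureAtInertTwo` is EQUIVALENT to the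
statement that on every H₂ frame either `P(1) = y_K` is not `2`-divisible in `E(K[1])` (depth `0`, the landed `stub_levelOne`) or there
are a square-free `n` whose prime factors are CM-inert Zhang–Kolyvagin primes at `2` and a datum `d` of conductor `n` such that for EVERY
`Θ ∈ K[n]` with `Θ ≠ 0`, `Θ² = c ∈ ℚ`, `σ_ℓΘ = −Θ` (`ℓ ∣ n`) and every sign function `χ` of `Θ` (`χ(g) = 1` if `gΘ = Θ`, `−1` otherwise)
— such `Θ` exist with `c = n*` (`exists_prod_sqrt_of_isKolyvaginPrime`) — the SIGNED genus trace `G_χ = Σ_{s∈S} χ(s)·s(𝒩_n y(n))` is NOT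
`2R` with `R = O` or `R = (x, y)`, `x = ι k₁`, `(2y + a₁x + a₃)/Θ = ι k₂`, `c·k₂² = 4k₁³ + b₂k₁² + 2b₄k₁ + b₆` for some `k₁, k₂ ∈ K`
(i.e. `R` the transport `ι_Θ` of a `K`-rational point of `E^{(c)}`). Since `G_χ ∈ ι_Θ(E^{(n*)}(K)) ∪ {O}` itself
(`genusTraceChi_eq_zero_or_rational_twistCoords`), the open stub `stub_positiveDepth` (= GT∀ of the cell's censuses) reads, in
Mordell–Weil language over the FIXED field `K`: at some level `n`, a `K`-rational point of ONE quadratic twist `E^{(n*)}` is not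
`2`-divisible in `E^{(n*)}(K)` (`E^{(n*)}(K) ⊇ E^{(n*)}(ℚ) ⊕ E^{(d_Kn*)}(ℚ)`).

HONEST FRAMING: a by-name repackaging of landed theorems; nothing is closed; BSD is proved for no curve. Beyond-print: no.
References: [cite: GrossLMS1991, §3 (3.5), Prop. 3.7 (1), §4 (4.1)] [cite: SilvermanAEC2009, X.5 Cor. 5.4] [cite: Cox2013, Thm. 9.18, §9.A].
-/

set_option linter.dupNamespace false -- `Summit.BirchSwinnertonDyer.BirchSwinnertonDyer.Theorems.…` (summit = sub)
set_option autoImplicit false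

noncomputable section

open scoped Classical

namespace Summit.BirchSwinnertonDyer.BirchSwinnertonDyer.Theorems.CMKolyvaginConjecturePositiveDepth

open Finset WeierstrassCurve NumberField
open Literature.NumberTheory.EllipticCurves Literature.NumberTheory.EllipticCurves.ModularForms
open Literature.NumberTheory.EllipticCurves.Rank1Residual
open Summit.BirchSwinnertonDyer.BirchSwinnertonDyer.Theses.CMKolyvaginAtInertTwo (CMKolyvaginConjectureAtInertTwo)

/-- **Crux 24648 BY NAME ⟺ the rational twist dichotomy over `K`** (see the module docstring).
[cite: GrossLMS1991, §3 (3.5), Prop. 3.7 (1), §4 (4.1)] [cite: SilvermanAEC2009, X.5 Cor. 5.4] [cite: Cox2013, Thm. 9.18, §9.A] -/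
theorem cmKolyvaginConjectureAtInertTwo_iff_rationalTwistDichotomy :
    CMKolyvaginConjectureAtInertTwo ↔
    ∀ (W : WeierstrassCurve ℚ) [W.IsElliptic] [W.IsGloballyMinimal] [NeZero (W.conductorNorm ℤ)], W.HasCM →
      Literature.NumberTheory.EllipticCurves.Rank1Residual.CMInert W 2 → W.HasSurjectiveModNGaloisRep (2 : ℤ) →
      W.analyticRank = 1 → Odd W.tamagawaProduct → ∀ (K : Type) [Field K] [NumberField K],
      Literature.NumberTheory.EllipticCurves.IsImaginaryQuadratic K → Odd (NumberField.discr K) → NumberField.discr K ≠ -3 →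
      Literature.NumberTheory.EllipticCurves.SatisfiesHeegnerHypothesis (W.conductorNorm ℤ) K →
      ∀ (Dt : Literature.NumberTheory.EllipticCurves.ModularForms.ModularParametrizationData W (W.conductorNorm ℤ)),
      (∀ z ∈ Dt.L.lattice, ∃ w ∈ Literature.NumberTheory.EllipticCurves.ModularForms.periodLattice Dt.f, z = (Dt.c : ℂ) * w) →
      Odd Dt.c → ∀ (β : ℤ) (ι : K →+* ℂ) (d₁ : Literature.NumberTheory.EllipticCurves.KolyvaginHeegnerData Dt β ι 1),
      ¬ IsOfFinAddOrder d₁.derivedPoint →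
      (¬ ∃ Q : (W.baseChange (ringClassField K ι 1)).toAffine.Point, (2 : ℤ) • Q = d₁.derivedPoint) ∨
      ∃ (n : ℕ) (d : KolyvaginHeegnerData Dt β ι n), Squarefree n ∧
        (∀ ℓ ∈ n.primeFactors, (Zhang2014.IsKolyvaginPrime (W.conductorNorm ℤ) W K 2 ℓ ∧ CMInert W ℓ)) ∧
        ∀ (Θ : ringClassField K ι n) (c : ℚ), Θ ≠ 0 → Θ ^ 2 = algebraMap ℚ (ringClassField K ι n) c →
          (∀ ℓ ∈ n.primeFactors, d.σ ℓ Θ = -Θ) →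
          ∀ χ : (ringClassField K ι n ≃ₐ[ℚ] ringClassField K ι n) → ℤ,
            (∀ g, g Θ = Θ → χ g = 1) → (∀ g, g Θ ≠ Θ → χ g = -1) →
          ¬ ∃ R : (W.baseChange (ringClassField K ι n)).toAffine.Point,
            (2 : ℤ) • R = ∑ s ∈ d.S, χ s • pointGalHom W (ringClassField K ι n) s
                (n.primeFactorsList.foldr
                  (fun q x ↦ ∑ k ∈ range ((q + 1) / 2), pointGalHom W (ringClassField K ι n) ((d.σ q ^ 2) ^ k) x) d.y) ∧
            ∀ (x y : ringClassField K ι n) (h : (W.baseChange (ringClassField K ι n)).toAffine.Nonsingular x y),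
              R = .some x y h →
                ∃ k₁ k₂ : K, ι k₁ = x ∧
                  ι k₂ = (((2 * y + (W.baseChange (ringClassField K ι n)).toAffine.a₁ * x +
                    (W.baseChange (ringClassField K ι n)).toAffine.a₃) / Θ : ringClassField K ι n) : ℂ) ∧
                  (c : K) * k₂ ^ 2 = 4 * k₁ ^ 3 + (W.b₂ : K) * k₁ ^ 2 + 2 * (W.b₄ : K) * k₁ + (W.b₆ : K) := by
  constructor
  · intro hKC W _ _ _ hCM hin hρ hr hT K _ _ hK hodd h3 hH Dt hDt hc β ι d₁ hy
    by_cases h2 : ∃ Q : (W.baseChange (ringClassField K ι 1)).toAffine.Point, (2 : ℤ) • Q = d₁.derivedPoint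
    · obtain ⟨n, d, hn, hKol, hP⟩ := hKC W hCM hin hρ hr hT K hK hodd h3 hH Dt hDt hc β ι d₁ hy
      refine Or.inr ⟨n, d, hn, hKol, fun Θ c hΘ hΘ2 hΘneg χ hχp hχn hR ↦ hP ?_⟩
      exact (two_dvd_derivedPoint_iff_exists_rational_twistCoords_allLevels W hCM hin hρ hK hodd h3 hH hn hKol d hΘ hΘ2
        hΘneg χ hχp hχn).mpr hR
    · exact Or.inl h2
  · intro h W _ _ _ hCM hin hρ hr hT K _ _ hK hodd h3 hH Dt hDt hc β ι d₁ hy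
    rcases h W hCM hin hρ hr hT K hK hodd h3 hH Dt hDt hc β ι d₁ hy with h0 | ⟨n, d, hn, hKol, hG⟩
    · exact ⟨1, d₁, squarefree_one, fun ℓ hℓ ↦ absurd hℓ (by simp), h0⟩
    · obtain ⟨Θ, hΘ2, hΘ, hΘneg⟩ := exists_prod_sqrt_of_isKolyvaginPrime hK W hn (fun ℓ hℓ ↦ (hKol ℓ hℓ).1) d
      have hχp : ∀ g : ringClassField K ι n ≃ₐ[ℚ] ringClassField K ι n,
          g Θ = Θ → (if g Θ = Θ then (1 : ℤ) else -1) = 1 := fun g hg ↦ if_pos hg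
      have hχn : ∀ g : ringClassField K ι n ≃ₐ[ℚ] ringClassField K ι n,
          g Θ ≠ Θ → (if g Θ = Θ then (1 : ℤ) else -1) = -1 := fun g hg ↦ if_neg hg
      refine ⟨n, d, hn, hKol, fun hP ↦ hG Θ _ hΘ hΘ2 hΘneg _ hχp hχn ?_⟩
      exact (two_dvd_derivedPoint_iff_exists_rational_twistCoords_allLevels W hCM hin hρ hK hodd h3 hH hn hKol d hΘ hΘ2
        hΘneg _ hχp hχn).mp hP

end Summit.BirchSwinnertonDyer.BirchSwinnertonDyer.Theorems.CMKolyvaginConjecturePositiveDepth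

end
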